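import Literature.NumberTheory.Automorphic.TorusLieDual
import HarnessLib

/-!
# The Lie algebra of a torus is simultaneously diagonalisable and spanned by elements with INTEGER eigenvalues
(trunk T-AUTOMORPHIC vocabulary `Literature.NumberTheory.Automorphic`: `IsTorusSubgroup T` for `T ≤ GL n k`, `lieAlgebraGL`,
`characterLattice`; Springer, *Linear Algebraic Groups*, 3.2.7, 3.2.10 (4), 4.4.10 (3), 4.4.13)

Lane `lit-hodgefound` (Track 2 foundations library), prover seat `lit-hodgefound-p17` (generation 44, self-proposed row
g44-#2).  THEOREMS ONLY (no definition, no instance, no notation, no named fact; net debt 0).  Companion of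
`TorusLieDual.lean` (`lieAlgebraGL_eq_torusLie_of_le_diagonal`: for an algebraic `T ≤ 𝔻ₙ`,
`Lie(T) = {diag(ℓ(wt a))_a | ℓ ∈ Hom(X*(T), k)}`; `lieTorusDual_bijective`: `Lie(T) ≅ Hom(X*(T), k)`) and of
`TorusCharacters.lean` (`exists_conj_le_diagonalSubgroup`, 2.4.2 (ii) ∕ 3.2.3: a torus is conjugate into `𝔻ₙ`;
`exists_dualBases_of_isTorusSubgroup`, 3.2.7 ∕ 3.2.11 (i): `X*(T) ≅ ℤʳ`).

## What is proved (over an algebraically closed field `k`)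

For a torus `T ≤ GL n k`:

* **`IsTorusSubgroup.exists_integral_diagonal_span_of_le_diagonal`** — if `T ≤ 𝔻ₙ`, there are finitely many INTEGER
  vectors `m_1, …, m_r ∈ ℤⁿ` whose diagonal matrices `diag(m_i)` lie in `Lie(T)` and span it over `k`
  (the coordinates of the diagonal weights in a `ℤ`-basis of `X*(T)`; Springer 4.4.13: `Lie(T) = k ⊗ X_*(T)`).
* **`IsTorusSubgroup.exists_conj_integral_diagonal_span`** — in general there are `g ∈ GL n k` and
  `m_1, …, m_r ∈ ℤⁿ` with `g⁻¹ diag(m_i) g ∈ Lie(T)` spanning `Lie(T)`: THE LIE ALGEBRA OF A TORUS HAS A `k`-BASIS OF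
  ELEMENTS WITH INTEGER EIGENVALUES in a COMMON eigenbasis (the columns of `g⁻¹`).
* Consequences: `IsTorusSubgroup.exists_conj_forall_eq_diagonal` (`Lie(T)` is simultaneously diagonalisable:
  `g H g⁻¹` is diagonal for every `H ∈ Lie(T)`), `IsTorusSubgroup.mul_comm_of_mem_lieAlgebraGL` (`Lie(T)` is
  commutative), `IsTorusSubgroup.exists_conj_forall_mulVec_eq_smul` (a common eigenbasis `v_a = g⁻¹ e_a` with
  `H v_a = (g H g⁻¹)_{aa} v_a`), and the RATIONAL FORM statement
  `IsTorusSubgroup.exists_conj_span_integral_eigenvalues`: `Lie(T)` is the `k`-span of its elements all of whose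
  eigenvalues `(g H g⁻¹)_{aa}` are integers.

## Why it is here (consumer)

The `ℚ`-structure of a `ℚ`-torus `S ≤ GL_N(ℂ)` (Zariski-closed, `Aut(ℂ)`-stable) that the GALOIS MODULE `X_*(S)` carries is
read inside `Lie(S) = X_*(S) ⊗ ℂ` as the `ℚ`-span of the elements with rational eigenvalues; `Aut(ℂ)` permutes the joint
eigenvalue functionals.  The sequel (`Literature/Geometry/Kaehler/…`, Moonen–Zarhin 1999 Prop. (3.8), CM case: «the center
of `Hg(X)` contains a torus `ℚ`-isogenous to `U_k` ⟹ `k ↪ centre End⁰(X)`») applies this to the connected centre of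
`Hg(X × E)(ℂ)`.

## References

* [Springer1998] T. A. Springer, *Linear Algebraic Groups*, 2nd ed. (1998): 3.2.3, 3.2.7, 3.2.10 (4), 4.4.10 (3), 4.4.13
  («`𝔱 = k ⊗ X_*(T)`»).
* [Borel1991] A. Borel, *Linear Algebraic Groups*, 2nd ed., §8.2 (diagonalisable groups and their Lie algebras).
-/

noncomputable section

open scoped MatrixGroups

namespace Literature.NumberTheory.Automorphic

variable {k : Type*} [Field k] {n : Type*} [Fintype n] [DecidableEq n] {T : Subgroup (GL n k)}

/-! ### §1 Inside the diagonal torus -/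

/-- **Springer 4.4.13 for `T ≤ 𝔻ₙ`: `Lie(T)` is spanned over `k` by INTEGER diagonal matrices lying in `Lie(T)`.**  With
`wt_a ∈ X*(T)` the diagonal weights and `b : X*(T) ≃ ℤʳ` a basis, the matrices are `diag(b(wt_a)_i)_a`, `i < r`, and
`diag(ℓ(wt_a))_a = ∑_i ℓ(b⁻¹ e_i) · diag(b(wt_a)_i)_a` for every `ℓ ∈ Hom(X*(T), k)`.
[cite: Springer1998, 4.4.13 and 3.2.10 (4)] -/
theorem IsTorusSubgroup.exists_integral_diagonal_span_of_le_diagonal [IsAlgClosed k] (hT : IsTorusSubgroup T)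
    (hle : T ≤ diagonalSubgroup n k) :
    ∃ (r : ℕ) (m : Fin r → n → ℤ),
      (∀ i, Matrix.diagonal (fun a ↦ ((m i a : ℤ) : k)) ∈ lieAlgebraGL T) ∧
      ∀ H ∈ lieAlgebraGL T, ∃ c : Fin r → k, H = ∑ i, c i • Matrix.diagonal (fun a ↦ ((m i a : ℤ) : k)) := by
  haveI : IsMulCommutative ↥T := hT.2.1
  obtain ⟨r, bX, -, -⟩ := exists_dualBases_of_isTorusSubgroup hT
  set wt := diagLatticeWt hle with hwt
  have hLie : lieAlgebraGL T = torusLie (k := k) wt := lieAlgebraGL_eq_torusLie_of_le_diagonal hT.1.1 hle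
  -- the integer-valued functionals `ℓ_i = (i-th coordinate) ∘ b`
  let ℓ : Fin r → (Additive ↥(characterLattice T) →+ k) := fun i ↦
    (Int.castAddHom k).comp ((Pi.evalAddMonoidHom (fun _ : Fin r ↦ ℤ) i).comp bX.toAddMonoidHom)
  have hℓ : ∀ i x, ℓ i x = ((bX x i : ℤ) : k) := fun i x ↦ rfl
  refine ⟨r, fun i a ↦ bX (wt a) i, fun i ↦ ?_, fun H hH ↦ ?_⟩
  · -- `diag(b(wt_a)_i) = torusDiag wt ℓ_i ∈ torusLie wt = Lie(T)`
    have h : Matrix.diagonal (fun a ↦ ((bX (wt a) i : ℤ) : k)) = torusDiag wt (ℓ i) := by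
      ext a c
      rw [torusDiag_apply, Matrix.diagonal_apply, hℓ]
    rw [hLie, h, mem_torusLie_iff]
    exact ⟨ℓ i, rfl⟩
  · rw [hLie, mem_torusLie_iff] at hH
    obtain ⟨L, rfl⟩ := hH
    refine ⟨fun i ↦ L (bX.symm (Pi.single i 1)), ?_⟩
    -- `L x = ∑_i (b x)_i · L (b⁻¹ e_i)`
    have hL : ∀ x, L x = ∑ i, L (bX.symm (Pi.single i 1)) * ((bX x i : ℤ) : k) := by
      intro x
      have hx : x = ∑ i, (bX x i) • bX.symm (Pi.single i 1) := by
        apply bX.injective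
        rw [map_sum]
        conv_lhs => rw [show bX x = ∑ i, (bX x i) • (Pi.single i (1 : ℤ) : Fin r → ℤ) from by
          funext j; simp [Finset.sum_apply, Pi.single_apply]]
        refine Finset.sum_congr rfl fun i _ ↦ ?_
        rw [map_zsmul, AddEquiv.apply_symm_apply]
      conv_lhs => rw [hx]
      rw [map_sum]
      refine Finset.sum_congr rfl fun i _ ↦ ?_
      rw [map_zsmul, zsmul_eq_mul, mul_comm]
    ext a c
    rw [torusDiag_apply, Matrix.sum_apply]
    simp only [Matrix.smul_apply, Matrix.diagonal_apply, smul_eq_mul]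
    split_ifs with hac
    · rw [hL]
    · simp

/-! ### §2 A general torus -/

/-- **THE LIE ALGEBRA OF A TORUS IS SPANNED BY ELEMENTS WITH INTEGER EIGENVALUES IN A COMMON EIGENBASIS** (Springer
4.4.13 `𝔱 = k ⊗_ℤ X_*(T)`, read in `𝔤𝔩ₙ`): for a torus `T ≤ GL n k` over an algebraically closed field there are
`g ∈ GL n k` and integer vectors `m_1, …, m_r ∈ ℤⁿ` such that the matrices `g⁻¹ diag(m_i) g` lie in `Lie(T)` and every
`H ∈ Lie(T)` is a `k`-linear combination of them.  (`g` conjugates `T` into `𝔻ₙ`, Springer 3.2.3 ∕ 2.4.2 (ii); then §1 and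
`Lie(g T g⁻¹) = g Lie(T) g⁻¹`, 4.4.5 (ii).) [cite: Springer1998, 4.4.13, 4.4.5 (ii) and 3.2.3] -/
theorem IsTorusSubgroup.exists_conj_integral_diagonal_span [IsAlgClosed k] (hT : IsTorusSubgroup T) :
    ∃ (g : GL n k) (r : ℕ) (m : Fin r → n → ℤ),
      (∀ i, ((g⁻¹ : GL n k) : Matrix n n k) * Matrix.diagonal (fun a ↦ ((m i a : ℤ) : k)) * (g : Matrix n n k) ∈
          lieAlgebraGL T) ∧
      ∀ H ∈ lieAlgebraGL T, ∃ c : Fin r → k,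
        H = ∑ i, c i • (((g⁻¹ : GL n k) : Matrix n n k) * Matrix.diagonal (fun a ↦ ((m i a : ℤ) : k)) *
          (g : Matrix n n k)) := by
  obtain ⟨g, hg⟩ := exists_conj_le_diagonalSubgroup hT.2.1 hT.2.2
  rw [MulEquiv.toMonoidHom_eq_coe] at hg
  have hT' : IsTorusSubgroup (T.map (MulAut.conj g : GL n k →* GL n k)) := hT.map_conj g
  obtain ⟨r, m, hmem, hspan⟩ := hT'.exists_integral_diagonal_span_of_le_diagonal hg
  refine ⟨g, r, m, fun i ↦ inv_conj_mem_lieAlgebraGL_of_mem_map_conj g (hmem i), fun H hH ↦ ?_⟩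
  obtain ⟨c, hc⟩ := hspan _ (conj_mem_lieAlgebraGL_map_conj g hH)
  refine ⟨c, ?_⟩
  calc H = ((g⁻¹ : GL n k) : Matrix n n k) * ((g : Matrix n n k) * H * ((g⁻¹ : GL n k) : Matrix n n k)) *
        (g : Matrix n n k) := (units_inv_conj_conj g H).symm
    _ = ((g⁻¹ : GL n k) : Matrix n n k) * (∑ i, c i • Matrix.diagonal (fun a ↦ ((m i a : ℤ) : k))) *
        (g : Matrix n n k) := by rw [← hc]
    _ = ∑ i, c i • (((g⁻¹ : GL n k) : Matrix n n k) * Matrix.diagonal (fun a ↦ ((m i a : ℤ) : k)) *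
        (g : Matrix n n k)) := by
      rw [Finset.mul_sum, Finset.sum_mul]
      refine Finset.sum_congr rfl fun i _ ↦ ?_
      rw [Matrix.mul_smul, Matrix.smul_mul]

/-- **`Lie(T)` is simultaneously diagonalisable**: for a torus `T ≤ GL n k` there is `g ∈ GL n k` with `g H g⁻¹` diagonal
for every `H ∈ Lie(T)` (Springer 4.4.10 (3) ∕ 4.4.13: `Lie(𝔻ₙ)` is the diagonal matrices, and `Lie(g⁻¹ T' g) = g⁻¹ Lie(T') g`).
[cite: Springer1998, 4.4.13 and 4.4.5 (ii)] -/
theorem IsTorusSubgroup.exists_conj_forall_eq_diagonal [IsAlgClosed k] (hT : IsTorusSubgroup T) :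
    ∃ g : GL n k, ∀ H ∈ lieAlgebraGL T, ∃ d : n → k,
      (g : Matrix n n k) * H * ((g⁻¹ : GL n k) : Matrix n n k) = Matrix.diagonal d := by
  obtain ⟨g, r, m, -, hspan⟩ := hT.exists_conj_integral_diagonal_span
  refine ⟨g, fun H hH ↦ ?_⟩
  obtain ⟨c, hc⟩ := hspan H hH
  refine ⟨fun a ↦ ∑ i, c i * ((m i a : ℤ) : k), ?_⟩
  rw [hc, Finset.mul_sum, Finset.sum_mul]
  have h : ∀ i, (g : Matrix n n k) * (c i • (((g⁻¹ : GL n k) : Matrix n n k) *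
      Matrix.diagonal (fun a ↦ ((m i a : ℤ) : k)) * (g : Matrix n n k))) * ((g⁻¹ : GL n k) : Matrix n n k) =
        c i • Matrix.diagonal (fun a ↦ ((m i a : ℤ) : k)) := by
    intro i
    rw [Matrix.mul_smul, Matrix.smul_mul, units_conj_inv_conj]
  rw [Finset.sum_congr rfl fun i _ ↦ h i]
  ext a b
  rw [Matrix.sum_apply, Matrix.diagonal_apply]
  simp only [Matrix.smul_apply, Matrix.diagonal_apply, smul_eq_mul]
  split_ifs with hab
  · rfl
  · simp

/-- The eigenvalue read-off: if `g H g⁻¹ = diag(d)` then `d_a = (g H g⁻¹)_{aa}`. [folklore] -/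
private theorem diag_eq_conj_apply {g : GL n k} {H : Matrix n n k} {d : n → k}
    (h : (g : Matrix n n k) * H * ((g⁻¹ : GL n k) : Matrix n n k) = Matrix.diagonal d) (a : n) :
    d a = ((g : Matrix n n k) * H * ((g⁻¹ : GL n k) : Matrix n n k)) a a := by
  rw [h, Matrix.diagonal_apply_eq]

/-- **`Lie(T)` is commutative** for a torus `T` (two simultaneously diagonalisable matrices commute; equivalently
Springer 4.4.13: `𝔱` is abelian). [cite: Springer1998, 4.4.13] -/
theorem IsTorusSubgroup.mul_comm_of_mem_lieAlgebraGL [IsAlgClosed k] (hT : IsTorusSubgroup T) {H H' : Matrix n n k}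
    (hH : H ∈ lieAlgebraGL T) (hH' : H' ∈ lieAlgebraGL T) : H * H' = H' * H := by
  obtain ⟨g, hg⟩ := hT.exists_conj_forall_eq_diagonal
  obtain ⟨d, hd⟩ := hg H hH
  obtain ⟨d', hd'⟩ := hg H' hH'
  have hH₁ : H = ((g⁻¹ : GL n k) : Matrix n n k) * Matrix.diagonal d * (g : Matrix n n k) := by
    rw [← hd, units_inv_conj_conj]
  have hH₂ : H' = ((g⁻¹ : GL n k) : Matrix n n k) * Matrix.diagonal d' * (g : Matrix n n k) := by
    rw [← hd', units_inv_conj_conj]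
  rw [hH₁, hH₂]
  have hgg : (g : Matrix n n k) * ((g⁻¹ : GL n k) : Matrix n n k) = 1 := by
    rw [← Units.val_mul, mul_inv_cancel, Units.val_one]
  calc ((g⁻¹ : GL n k) : Matrix n n k) * Matrix.diagonal d * (g : Matrix n n k) *
        (((g⁻¹ : GL n k) : Matrix n n k) * Matrix.diagonal d' * (g : Matrix n n k))
      = ((g⁻¹ : GL n k) : Matrix n n k) * (Matrix.diagonal d * ((g : Matrix n n k) *
          ((g⁻¹ : GL n k) : Matrix n n k)) * Matrix.diagonal d') * (g : Matrix n n k) := by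
        simp only [Matrix.mul_assoc]
    _ = ((g⁻¹ : GL n k) : Matrix n n k) * (Matrix.diagonal d' * ((g : Matrix n n k) *
          ((g⁻¹ : GL n k) : Matrix n n k)) * Matrix.diagonal d) * (g : Matrix n n k) := by
        rw [hgg, Matrix.mul_one, Matrix.mul_one, Matrix.diagonal_mul_diagonal, Matrix.diagonal_mul_diagonal]
        congr 3
        funext a
        exact mul_comm _ _
    _ = ((g⁻¹ : GL n k) : Matrix n n k) * Matrix.diagonal d' * (g : Matrix n n k) *
        (((g⁻¹ : GL n k) : Matrix n n k) * Matrix.diagonal d * (g : Matrix n n k)) := by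
        simp only [Matrix.mul_assoc]

/-- **A common eigenbasis for `Lie(T)`**: with `g` as in `exists_conj_forall_eq_diagonal`, the columns `v_a = g⁻¹ e_a` of
`g⁻¹` satisfy `H v_a = (g H g⁻¹)_{aa} · v_a` for every `H ∈ Lie(T)`; they are non-zero (indeed a basis, `g⁻¹` being
invertible). [cite: Springer1998, 4.4.13] -/
theorem IsTorusSubgroup.exists_conj_forall_mulVec_eq_smul [IsAlgClosed k] (hT : IsTorusSubgroup T) :
    ∃ g : GL n k, (∀ H ∈ lieAlgebraGL T, ∀ a b : n, a ≠ b →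
        ((g : Matrix n n k) * H * ((g⁻¹ : GL n k) : Matrix n n k)) a b = 0) ∧
      ∀ H ∈ lieAlgebraGL T, ∀ a : n,
        H.mulVec (((g⁻¹ : GL n k) : Matrix n n k).mulVec (Pi.single a 1)) =
          ((g : Matrix n n k) * H * ((g⁻¹ : GL n k) : Matrix n n k)) a a •
            ((g⁻¹ : GL n k) : Matrix n n k).mulVec (Pi.single a 1) := by
  obtain ⟨g, hg⟩ := hT.exists_conj_forall_eq_diagonal
  refine ⟨g, fun H hH a b hab ↦ ?_, fun H hH a ↦ ?_⟩
  · obtain ⟨d, hd⟩ := hg H hH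
    rw [hd, Matrix.diagonal_apply_ne _ hab]
  · obtain ⟨d, hd⟩ := hg H hH
    have hH₁ : H = ((g⁻¹ : GL n k) : Matrix n n k) * Matrix.diagonal d * (g : Matrix n n k) := by
      rw [← hd, units_inv_conj_conj]
    have hgg : (g : Matrix n n k) * ((g⁻¹ : GL n k) : Matrix n n k) = 1 := by
      rw [← Units.val_mul, mul_inv_cancel, Units.val_one]
    rw [← diag_eq_conj_apply hd a]
    conv_lhs => rw [hH₁]
    rw [Matrix.mulVec_mulVec, Matrix.mul_assoc, hgg, Matrix.mul_one, ← Matrix.mulVec_mulVec,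
      Matrix.diagonal_mulVec_single, mul_one, ← Matrix.mulVec_smul]
    congr 1
    ext b
    simp [Pi.single_apply]

/-- **THE RATIONAL FORM OF `Lie(T)` BY EIGENVALUES** (Springer 4.4.13, `X_*(T) ⊗ ℤ ⊂ 𝔱`): for a torus `T ≤ GL n k` there is
`g ∈ GL n k` simultaneously diagonalising `Lie(T)` such that `Lie(T)` is the `k`-span of those of its elements `H` all of
whose eigenvalues `(g H g⁻¹)_{aa}` are INTEGERS. [cite: Springer1998, 4.4.13] -/
theorem IsTorusSubgroup.exists_conj_span_integral_eigenvalues [IsAlgClosed k] (hT : IsTorusSubgroup T) :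
    ∃ g : GL n k,
      (∀ H ∈ lieAlgebraGL T, ∃ d : n → k,
          (g : Matrix n n k) * H * ((g⁻¹ : GL n k) : Matrix n n k) = Matrix.diagonal d) ∧
      lieAlgebraGL T ≤ Submodule.span k {H : Matrix n n k | H ∈ lieAlgebraGL T ∧
        ∀ a : n, ∃ z : ℤ, ((g : Matrix n n k) * H * ((g⁻¹ : GL n k) : Matrix n n k)) a a = (z : k)} := by
  obtain ⟨g, r, m, hmem, hspan⟩ := hT.exists_conj_integral_diagonal_span
  refine ⟨g, fun H hH ↦ ?_, fun H hH ↦ ?_⟩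
  · obtain ⟨c, hc⟩ := hspan H hH
    refine ⟨fun a ↦ ∑ i, c i * ((m i a : ℤ) : k), ?_⟩
    rw [hc, Finset.mul_sum, Finset.sum_mul]
    have h : ∀ i, (g : Matrix n n k) * (c i • (((g⁻¹ : GL n k) : Matrix n n k) *
        Matrix.diagonal (fun a ↦ ((m i a : ℤ) : k)) * (g : Matrix n n k))) * ((g⁻¹ : GL n k) : Matrix n n k) =
          c i • Matrix.diagonal (fun a ↦ ((m i a : ℤ) : k)) := by
      intro i
      rw [Matrix.mul_smul, Matrix.smul_mul, units_conj_inv_conj]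
    rw [Finset.sum_congr rfl fun i _ ↦ h i]
    ext a b
    rw [Matrix.sum_apply, Matrix.diagonal_apply]
    simp only [Matrix.smul_apply, Matrix.diagonal_apply, smul_eq_mul]
    split_ifs with hab
    · rfl
    · simp
  · obtain ⟨c, hc⟩ := hspan H hH
    rw [hc]
    refine Submodule.sum_mem _ fun i _ ↦ Submodule.smul_mem _ _ (Submodule.subset_span ⟨hmem i, fun a ↦ ⟨m i a, ?_⟩⟩)
    rw [units_conj_inv_conj, Matrix.diagonal_apply_eq]

end Literature.NumberTheory.Automorphic

end
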